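import Summits.CriticalPhenomena.Ising3D.Control2DVertexRecursion
import Summits.CriticalPhenomena.Ising3D.Control2DNonVacuity
import Mathlib.Analysis.SpecialFunctions.Log.Deriv
import Mathlib.Tactic
import HarnessLib

/-!
# The free-boson vertex-operator witness, III: the product rule `k_2 k_{2a} = Σ_k E_k(a) k_{2(a+1+2k)}`
and the powers `k_2^{j+1} = Σ_n e_{j,n} k_{2n}` as `HasSum` identities
(cell `pub-ising3x`, seat controls-1 gen 36; NON-VACUITY of the 2D control's hypothesis classes WITH a
stress tensor, step 3 of 5 — CONTROL-ONLY)

HONEST FRAMING: lottery ticket; floor = tightest certified 3D Ising CFT bounds; no exact-solution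
claim without a proof. CONTROL-ONLY (`d = 2`); nothing numerical is asserted here.

For `0 < x < 1` (`k_{2h} = chiralBlock h`): `chiralBlock_one_eq_neg_log` (`k_2(x) = -log(1-x)`), `chiralBlock_pos`;
`hasSum_vtxW_pow` (`Σ_M W_M x^{a+M} = k_2 k_{2a}`, Cauchy product by total degree); `hasSum_vtx_product` —
**`k_2(x) k_{2a}(x) = Σ_k E_k(a) k_{2(a+1+2k)}(x)`** for `a > 0` (`E_k(a) = vtxE a k ≥ 0`; coefficients matched
by `vtxW_eq_vtxW'`, Tonelli); `vtxECoeff j n = e_{j,n}` (`≥ 0`; `= 0` unless `n ≥ j+1`, `n ≡ j+1 (mod 2)`) and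
`hasSum_vtx_pow` — **`k_2(x)^{j+1} = Σ_n e_{j,n} k_{2n}(x)`** (induction on `j` with the product rule).
These feed `Control2DVertexExpansions` and the free-boson datum; positivity of every coefficient is
STRUCTURAL (sums of products of the positive `E_k`).

References: F. A. Dolan, H. Osborn, Nucl. Phys. B 678 (2004) 491, §3 [cite: DolanOsborn2004, §3];
Ph. Di Francesco, P. Mathieu, D. Sénéchal, Conformal Field Theory (Springer 1997), §9.1
[cite: DiFrancescoMathieuSenechal1997, §9.1]. Tree: `hasSum_chiralBlock` (`Control2DTermwise`),
`chiralBlock_nonneg` (`Control2DNonVacuity`), `vtxE`, `vtxW_eq_vtxW'` (`Control2DVertexRecursion`).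
-/

namespace Summit.CriticalPhenomena.Ising3D.Control2D

open Finset Set
open Literature.MathematicalPhysics.QuantumFieldTheory.ConformalBootstrap3D

section Chiral

variable {a q x : ℝ}

/-! ### `k_2 = -log(1-x)` and positivity of the chiral blocks -/

/-- `k_2(x) = Σ_i x^{i+1}/(i+1)` on `0 < x < 1`. [cite: DolanOsborn2004, §3] -/
theorem hasSum_chiralBlock_one (hx : x ∈ Ioo (0 : ℝ) 1) :
    HasSum (fun i : ℕ => x ^ (i + 1) / ((i : ℝ) + 1)) (chiralBlock 1 x) := by
  refine (hasSum_chiralBlock 1 hx.1 hx.2).congr_fun fun i => ?_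
  rw [chiralCoeff_one_left, ← Real.rpow_natCast]
  push_cast
  rw [add_comm (1 : ℝ) (i : ℝ)]
  ring

/-- **`k_2(x) = -log(1 - x)`** on `0 < x < 1`. [cite: DolanOsborn2004, §3] -/
theorem chiralBlock_one_eq_neg_log (hx : x ∈ Ioo (0 : ℝ) 1) : chiralBlock 1 x = -Real.log (1 - x) := by
  have habs : |x| < 1 := by rw [abs_lt]; constructor <;> linarith [hx.1, hx.2]
  exact (hasSum_chiralBlock_one hx).unique (Real.hasSum_pow_div_log_of_abs_lt_one habs)

/-- `k_{2h}(x) > 0` for `h ≥ 0`, `0 < x < 1` (the leading term `x^h` is positive, the rest non-negative).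
[folklore] -/
theorem chiralBlock_pos {h : ℝ} (hh : 0 ≤ h) (hx : x ∈ Ioo (0 : ℝ) 1) : 0 < chiralBlock h x := by
  have hs := hasSum_chiralBlock h hx.1 hx.2
  have h0 : chiralCoeff h 0 * x ^ (h + ((0 : ℕ) : ℝ)) = x ^ h := by
    rw [chiralCoeff_zero_right]; simp
  have hle := le_hasSum hs 0 (fun m _ => mul_nonneg (chiralCoeff_nonneg hh m) (Real.rpow_nonneg hx.1.le _))
  rw [h0] at hle
  exact lt_of_lt_of_le (Real.rpow_pos_of_pos hx.1 h) hle

/-! ### The product rule `k_2 k_{2a} = Σ_k E_k(a) k_{2(a+1+2k)}` -/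

/-- The Cauchy-product family of `k_2(x) k_{2a}(x)`, indexed by total degree:
`H(M, i) = [i+1 ≤ M] x^{i+1}/(i+1) · κ_a(M-1-i) x^{a+M-1-i}`. [folklore] -/
noncomputable def vtxCauchy (a x : ℝ) (Mi : ℕ × ℕ) : ℝ :=
  if Mi.2 + 1 ≤ Mi.1 then
    x ^ (Mi.2 + 1) / ((Mi.2 : ℝ) + 1) * (chiralCoeff a (Mi.1 - 1 - Mi.2) * x ^ (a + ((Mi.1 - 1 - Mi.2 : ℕ) : ℝ)))
  else 0

set_option maxHeartbeats 400000 in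
/-- **`Σ_M W_M x^{a+M} = k_2(x) k_{2a}(x)`**: the power series of the product (`a ≥ 0`, `0 < x < 1`).
[folklore] -/
theorem hasSum_vtxW_pow (ha : 0 ≤ a) (hx : x ∈ Ioo (0 : ℝ) 1) :
    HasSum (fun M : ℕ => vtxW a M * x ^ (a + (M : ℝ))) (chiralBlock 1 x * chiralBlock a x) := by
  have hf := hasSum_chiralBlock_one hx
  have hg := hasSum_chiralBlock a hx.1 hx.2
  have hf0 : ∀ i : ℕ, 0 ≤ x ^ (i + 1) / ((i : ℝ) + 1) := fun i => by
    have := hx.1; positivity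
  have hg0 : ∀ n, 0 ≤ chiralCoeff a n * x ^ (a + (n : ℝ)) := fun n =>
    mul_nonneg (chiralCoeff_nonneg ha n) (Real.rpow_nonneg hx.1.le _)
  have hP : HasSum (fun p : ℕ × ℕ => x ^ (p.1 + 1) / ((p.1 : ℝ) + 1) * (chiralCoeff a p.2 * x ^ (a + (p.2 : ℝ))))
      (chiralBlock 1 x * chiralBlock a x) :=
    hf.mul hg (hf.summable.mul_of_nonneg hg.summable hf0 hg0)
  -- re-index by total degree `M = i + n + 1`
  set ψ : ℕ × ℕ → ℕ × ℕ := fun p => (p.1 + p.2 + 1, p.1) with hψ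
  have hinj : Function.Injective ψ := by
    intro p p' h
    simp only [hψ, Prod.mk.injEq] at h
    obtain ⟨h1, h2⟩ := h
    exact Prod.ext h2 (by omega)
  have hcomp : vtxCauchy a x ∘ ψ =
      fun p : ℕ × ℕ => x ^ (p.1 + 1) / ((p.1 : ℝ) + 1) * (chiralCoeff a p.2 * x ^ (a + (p.2 : ℝ))) := by
    funext p
    simp only [Function.comp_apply, hψ, vtxCauchy]
    rw [if_pos (by omega), show p.1 + p.2 + 1 - 1 - p.1 = p.2 by omega]
  have hzero : ∀ Mi, Mi ∉ Set.range ψ → vtxCauchy a x Mi = 0 := by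
    intro Mi hMi
    unfold vtxCauchy
    split_ifs with hle
    · exfalso; apply hMi
      exact ⟨(Mi.2, Mi.1 - 1 - Mi.2), Prod.ext (by simp [hψ]; omega) (by simp [hψ])⟩
    · rfl
  have hH : HasSum (vtxCauchy a x) (chiralBlock 1 x * chiralBlock a x) :=
    (hinj.hasSum_iff hzero).1 (hcomp ▸ hP)
  refine hH.prod_fiberwise fun M => ?_
  -- the fibre over `M` is the finite sum `W_M x^{a+M}`
  cases M with
  | zero =>
    have : (fun i : ℕ => vtxCauchy a x (0, i)) = fun _ => 0 := by
      funext i; simp [vtxCauchy]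
    rw [this, vtxW_zero, zero_mul]
    exact hasSum_zero
  | succ L =>
    have hfin : ∀ i ∉ range (L + 1), vtxCauchy a x (L + 1, i) = 0 := by
      intro i hi
      rw [Finset.mem_range] at hi
      simp [vtxCauchy, show ¬ i + 1 ≤ L + 1 by omega]
    have hval : ∑ i ∈ range (L + 1), vtxCauchy a x (L + 1, i) = vtxW a (L + 1) * x ^ (a + ((L + 1 : ℕ) : ℝ)) := by
      rw [vtxW_succ, Finset.sum_mul, Nat.sum_antidiagonal_eq_sum_range_succ_mk]
      refine sum_congr rfl fun i hi => ?_
      rw [Finset.mem_range] at hi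
      simp only [vtxCauchy, if_pos (show i + 1 ≤ L + 1 by omega), show L + 1 - 1 - i = L - i by omega]
      rw [Nat.cast_sub (by omega : i ≤ L), ← Real.rpow_natCast x (i + 1)]
      have hx0 := hx.1
      rw [show x ^ (a + ((L : ℝ) - (i : ℝ))) = x ^ (((i + 1 : ℕ) : ℝ)) * x ^ (a + ((L : ℝ) - i))
          / x ^ (((i + 1 : ℕ) : ℝ)) by field_simp]
      rw [← Real.rpow_add hx0]
      push_cast
      rw [show (i : ℝ) + 1 + (a + (L - i)) = a + (L + 1) by ring]
      have : x ^ ((i : ℝ) + 1) ≠ 0 := (Real.rpow_pos_of_pos hx0 _).ne'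
      field_simp
    rw [← hval]
    exact hasSum_sum_of_ne_finset_zero hfin

/-- The block-side double family `F(k, n) = E_k(a) κ_{a+1+2k}(n) x^{(a+1+2k)+n} ≥ 0`. [folklore] -/
noncomputable def vtxProdDouble (a x : ℝ) (kn : ℕ × ℕ) : ℝ :=
  vtxE a kn.1 * (chiralCoeff (a + 1 + 2 * kn.1) kn.2 * x ^ (a + 1 + 2 * (kn.1 : ℝ) + (kn.2 : ℝ)))

/-- The same family re-indexed by total degree: `G(M, k) = [2k+1 ≤ M] F(k, M-1-2k)`. [folklore] -/
noncomputable def vtxProdDiag (a x : ℝ) (Mk : ℕ × ℕ) : ℝ :=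
  if 2 * Mk.2 + 1 ≤ Mk.1 then vtxProdDouble a x (Mk.2, Mk.1 - 1 - 2 * Mk.2) else 0

/-- The re-indexing map `(k, n) ↦ (n + 1 + 2k, k)`. [folklore] -/
def vtxProdReindex (kn : ℕ × ℕ) : ℕ × ℕ := (kn.2 + 1 + 2 * kn.1, kn.1)

/-- The re-indexing map is injective. [folklore] -/
theorem vtxProdReindex_injective : Function.Injective vtxProdReindex := by
  intro p p' h
  simp only [vtxProdReindex, Prod.mk.injEq] at h
  obtain ⟨h1, h2⟩ := h
  exact Prod.ext h2 (by omega)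

/-- `G ∘ reindex = F`. [folklore] -/
theorem vtxProdDiag_comp (a x : ℝ) : vtxProdDiag a x ∘ vtxProdReindex = vtxProdDouble a x := by
  funext p
  simp only [Function.comp_apply, vtxProdReindex, vtxProdDiag]
  rw [if_pos (by omega), show p.2 + 1 + 2 * p.1 - 1 - 2 * p.1 = p.2 by omega]

/-- `G` vanishes off the range of the re-indexing map. [folklore] -/
theorem vtxProdDiag_zero (a x : ℝ) (Mk : ℕ × ℕ) (h : Mk ∉ Set.range vtxProdReindex) :
    vtxProdDiag a x Mk = 0 := by
  unfold vtxProdDiag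
  split_ifs with hle
  · exfalso; apply h
    exact ⟨(Mk.2, Mk.1 - 1 - 2 * Mk.2), Prod.ext (by simp [vtxProdReindex]; omega) (by simp [vtxProdReindex])⟩
  · rfl

/-- `F ≥ 0` (`a > 0`, `x ≥ 0`). [folklore] -/
theorem vtxProdDouble_nonneg (ha : 0 < a) (hx : 0 ≤ x) (kn : ℕ × ℕ) : 0 ≤ vtxProdDouble a x kn := by
  unfold vtxProdDouble
  have h1 := vtxE_nonneg ha kn.1
  have h2 := chiralCoeff_nonneg (show (0 : ℝ) ≤ a + 1 + 2 * kn.1 by positivity) kn.2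
  have h3 : 0 ≤ x ^ (a + 1 + 2 * (kn.1 : ℝ) + (kn.2 : ℝ)) := Real.rpow_nonneg hx _
  positivity

/-- Rows of `G`: `Σ_k G(M, k) = W'_M x^{a+M}` (a finite sum). [folklore] -/
theorem hasSum_vtxProdDiag_row (a x : ℝ) (M : ℕ) :
    HasSum (fun k : ℕ => vtxProdDiag a x (M, k)) (vtxW' a M * x ^ (a + (M : ℝ))) := by
  cases M with
  | zero =>
    have : (fun k : ℕ => vtxProdDiag a x (0, k)) = fun _ => 0 := by
      funext k; simp [vtxProdDiag]
    rw [this, vtxW'_zero, zero_mul]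
    exact hasSum_zero
  | succ L =>
    have hfin : ∀ k ∉ range (L + 1), vtxProdDiag a x (L + 1, k) = 0 := by
      intro k hk
      rw [Finset.mem_range] at hk
      simp [vtxProdDiag, show ¬ 2 * k + 1 ≤ L + 1 by omega]
    have hval : ∑ k ∈ range (L + 1), vtxProdDiag a x (L + 1, k) =
        vtxW' a (L + 1) * x ^ (a + ((L + 1 : ℕ) : ℝ)) := by
      rw [vtxW'_succ, Finset.sum_mul]
      refine sum_congr rfl fun k hk => ?_
      by_cases h : 2 * k ≤ L
      · simp only [vtxProdDiag, if_pos (show 2 * k + 1 ≤ L + 1 by omega), if_pos h, vtxProdDouble,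
          show L + 1 - 1 - 2 * k = L - 2 * k by omega]
        rw [Nat.cast_sub h]
        push_cast
        rw [show a + 1 + 2 * (k : ℝ) + ((L : ℝ) - 2 * k) = a + (L + 1) by ring]
        ring
      · simp only [vtxProdDiag, if_neg (show ¬ 2 * k + 1 ≤ L + 1 by omega), if_neg h, zero_mul]
    rw [← hval]
    exact hasSum_sum_of_ne_finset_zero hfin

/-- **The product rule** `k_2(x) k_{2a}(x) = Σ_k E_k(a) k_{2(a+1+2k)}(x)` for `a > 0`, `0 < x < 1`
(`HasSum`; all terms non-negative). The function-level form of `vtxW_eq_vtxW'`. [folklore] -/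
theorem hasSum_vtx_product (ha : 0 < a) (hx : x ∈ Ioo (0 : ℝ) 1) :
    HasSum (fun k : ℕ => vtxE a k * chiralBlock (a + 1 + 2 * k) x) (chiralBlock 1 x * chiralBlock a x) := by
  have hW := hasSum_vtxW_pow ha.le hx
  have hrows := hasSum_vtxProdDiag_row a x
  have hGs : Summable (vtxProdDiag a x) := by
    refine (summable_prod_of_nonneg fun Mk => ?_).2 ⟨fun M => (hrows M).summable, ?_⟩
    · unfold vtxProdDiag
      split_ifs
      · exact vtxProdDouble_nonneg ha hx.1.le _
      · exact le_rfl
    · refine hW.summable.congr fun M => ?_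
      rw [(hrows M).tsum_eq, vtxW_eq_vtxW' ha M]
  have hG : HasSum (vtxProdDiag a x) (chiralBlock 1 x * chiralBlock a x) := by
    have h1 := hGs.hasSum
    have h2 := h1.prod_fiberwise hrows
    have h3 : HasSum (fun M : ℕ => vtxW' a M * x ^ (a + (M : ℝ))) (chiralBlock 1 x * chiralBlock a x) :=
      hW.congr_fun fun M => by rw [vtxW_eq_vtxW' ha M]
    rwa [h2.unique h3] at h1
  have hF : HasSum (vtxProdDouble a x) (chiralBlock 1 x * chiralBlock a x) := by
    rw [← vtxProdDiag_comp]
    exact (vtxProdReindex_injective.hasSum_iff (vtxProdDiag_zero a x)).2 hG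
  refine hF.prod_fiberwise fun k => ?_
  have h := (hasSum_chiralBlock (a + 1 + 2 * k) hx.1 hx.2).mul_left (vtxE a k)
  refine h.congr_fun fun n => ?_
  simp only [vtxProdDouble]

/-! ### Powers of `k_2`: `k_2^{j+1} = Σ_n e_{j,n} k_{2n}` -/

/-- `e_{j,n}`: the coefficient of `k_{2n}` in `k_2^{j+1}`, recursively through the product rule:
`e_{0,n} = [n = 1]`, `e_{j+1,N} = Σ_{2k+1 ≤ N} e_{j,N-1-2k} E_k(N-1-2k)`. [folklore] -/
noncomputable def vtxECoeff : ℕ → ℕ → ℝ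
  | 0, n => if n = 1 then 1 else 0
  | j + 1, N => ∑ k ∈ range N,
      if 2 * k + 1 ≤ N then vtxECoeff j (N - 1 - 2 * k) * vtxE (((N - 1 - 2 * k : ℕ) : ℝ)) k else 0

/-- Unfolding `e_{0,n}`. [folklore] -/
theorem vtxECoeff_zero (n : ℕ) : vtxECoeff 0 n = if n = 1 then 1 else 0 := rfl

/-- Unfolding `e_{j+1,N}`. [folklore] -/
theorem vtxECoeff_succ (j N : ℕ) : vtxECoeff (j + 1) N = ∑ k ∈ range N,
    (if 2 * k + 1 ≤ N then vtxECoeff j (N - 1 - 2 * k) * vtxE (((N - 1 - 2 * k : ℕ) : ℝ)) k else 0) := rfl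

/-- `e_{j,0} = 0` (no `k_0` component in a positive power of `k_2`). [folklore] -/
theorem vtxECoeff_zero_right : ∀ j : ℕ, vtxECoeff j 0 = 0
  | 0 => by simp [vtxECoeff_zero]
  | j + 1 => by simp [vtxECoeff_succ]

/-- `e_{j,n} = 0` for `n < j + 1` (`k_2^{j+1} = O(x^{j+1})`). [folklore] -/
theorem vtxECoeff_eq_zero_of_lt : ∀ (j : ℕ) {n : ℕ}, n < j + 1 → vtxECoeff j n = 0
  | 0, n, hn => by
    rw [vtxECoeff_zero, if_neg (by omega)]
  | j + 1, N, hN => by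
    rw [vtxECoeff_succ]
    refine sum_eq_zero fun k _ => ?_
    split_ifs with h
    · rw [vtxECoeff_eq_zero_of_lt j (by omega), zero_mul]
    · rfl

/-- Parity: `e_{j,n} = 0` unless `n ≡ j + 1 (mod 2)`. [folklore] -/
theorem vtxECoeff_eq_zero_of_parity : ∀ (j : ℕ) {n : ℕ}, (n + j) % 2 = 0 → vtxECoeff j n = 0
  | 0, n, hn => by
    rw [vtxECoeff_zero, if_neg (by omega)]
  | j + 1, N, hN => by
    rw [vtxECoeff_succ]
    refine sum_eq_zero fun k _ => ?_
    split_ifs with h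
    · rw [vtxECoeff_eq_zero_of_parity j (by omega), zero_mul]
    · rfl

/-- `e_{j,n} ≥ 0`. [folklore] -/
theorem vtxECoeff_nonneg : ∀ j n : ℕ, 0 ≤ vtxECoeff j n
  | 0, n => by
    rw [vtxECoeff_zero]; split_ifs <;> norm_num
  | j + 1, N => by
    rw [vtxECoeff_succ]
    refine sum_nonneg fun k _ => ?_
    split_ifs with h
    · by_cases h0 : N - 1 - 2 * k = 0
      · rw [h0, vtxECoeff_zero_right, zero_mul]
      · exact mul_nonneg (vtxECoeff_nonneg j _) (vtxE_nonneg (by positivity) k)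
    · exact le_rfl

/-- `e_{0,1} = 1`, `e_{1,2} = 1` (`k_2 = k_2`, `k_2² = k_4 + …`). [folklore] -/
theorem vtxECoeff_values : vtxECoeff 0 1 = 1 ∧ vtxECoeff 1 2 = 1 ∧ vtxECoeff 0 2 = 0 := by
  refine ⟨by simp [vtxECoeff_zero], ?_, by simp [vtxECoeff_zero]⟩
  rw [vtxECoeff_succ, sum_range_succ, sum_range_one]
  simp [vtxECoeff_zero, vtxE_zero one_pos]

/-- The double family behind the induction step: `D(n, k) = e_{j,n} E_k(n) k_{2(n+1+2k)}(x)`. [folklore] -/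
noncomputable def vtxPowDouble (j : ℕ) (x : ℝ) (nk : ℕ × ℕ) : ℝ :=
  vtxECoeff j nk.1 * (vtxE (nk.1 : ℝ) nk.2 * chiralBlock ((nk.1 : ℝ) + 1 + 2 * nk.2) x)

/-- Re-indexed: `G(N, k) = [2k+1 ≤ N] D(N-1-2k, k)`. [folklore] -/
noncomputable def vtxPowDiag (j : ℕ) (x : ℝ) (Nk : ℕ × ℕ) : ℝ :=
  if 2 * Nk.2 + 1 ≤ Nk.1 then vtxPowDouble j x (Nk.1 - 1 - 2 * Nk.2, Nk.2) else 0

/-- `G ∘ (n,k ↦ (n+1+2k,k)) = D`. [folklore] -/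
theorem vtxPowDiag_comp (j : ℕ) (x : ℝ) :
    vtxPowDiag j x ∘ (fun nk : ℕ × ℕ => (nk.1 + 1 + 2 * nk.2, nk.2)) = vtxPowDouble j x := by
  funext p
  simp only [Function.comp_apply, vtxPowDiag]
  rw [if_pos (by omega), show p.1 + 1 + 2 * p.2 - 1 - 2 * p.2 = p.1 by omega]

/-- **`k_2(x)^{j+1} = Σ_n e_{j,n} k_{2n}(x)`** on `0 < x < 1` (induction on `j` via the product rule and
Tonelli on the non-negative family `D`). [folklore] -/
theorem hasSum_vtx_pow (hx : x ∈ Ioo (0 : ℝ) 1) :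
    ∀ j : ℕ, HasSum (fun n : ℕ => vtxECoeff j n * chiralBlock n x) (chiralBlock 1 x ^ (j + 1))
  | 0 => by
    rw [zero_add, pow_one]
    refine (hasSum_ite_eq 1 (chiralBlock 1 x)).congr_fun fun n => ?_
    rw [vtxECoeff_zero]
    split_ifs with h
    · subst h; simp
    · simp
  | j + 1 => by
    have IH := hasSum_vtx_pow hx j
    have hk2 : 0 ≤ chiralBlock 1 x := chiralBlock_nonneg zero_le_one hx
    -- rows of D
    have hrow : ∀ n : ℕ, HasSum (fun k : ℕ => vtxPowDouble j x (n, k))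
        (vtxECoeff j n * (chiralBlock 1 x * chiralBlock n x)) := by
      intro n
      rcases Nat.eq_zero_or_pos n with hn | hn
      · subst hn
        have : (fun k : ℕ => vtxPowDouble j x (0, k)) = fun _ => 0 := by
          funext k; simp [vtxPowDouble, vtxECoeff_zero_right]
        rw [this, vtxECoeff_zero_right, zero_mul]
        exact hasSum_zero
      · have h := (hasSum_vtx_product (show (0 : ℝ) < n by exact_mod_cast hn) hx).mul_left (vtxECoeff j n)
        exact h.congr_fun fun k => by simp only [vtxPowDouble]
    have hD0 : ∀ nk, 0 ≤ vtxPowDouble j x nk := by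
      intro nk
      unfold vtxPowDouble
      rcases Nat.eq_zero_or_pos nk.1 with hn | hn
      · rw [hn, vtxECoeff_zero_right, zero_mul]
      · have h1 := vtxECoeff_nonneg j nk.1
        have h2 := vtxE_nonneg (show (0 : ℝ) < nk.1 by exact_mod_cast hn) nk.2
        have h3 := chiralBlock_nonneg (show (0 : ℝ) ≤ (nk.1 : ℝ) + 1 + 2 * nk.2 by positivity) hx
        positivity
    have htot : HasSum (fun n : ℕ => vtxECoeff j n * (chiralBlock 1 x * chiralBlock n x))
        (chiralBlock 1 x ^ (j + 1 + 1)) := by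
      have h := IH.mul_left (chiralBlock 1 x)
      rw [pow_succ, mul_comm]
      refine h.congr_fun fun n => ?_
      ring
    have hDs : Summable (vtxPowDouble j x) :=
      (summable_prod_of_nonneg hD0).2 ⟨fun n => (hrow n).summable,
        htot.summable.congr fun n => ((hrow n).tsum_eq).symm⟩
    have hD : HasSum (vtxPowDouble j x) (chiralBlock 1 x ^ (j + 1 + 1)) := by
      have h1 := hDs.hasSum
      rwa [(h1.prod_fiberwise hrow).unique htot] at h1
    -- re-index by N = n + 1 + 2k
    have hinj : Function.Injective (fun nk : ℕ × ℕ => (nk.1 + 1 + 2 * nk.2, nk.2)) := by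
      intro p p' h
      simp only [Prod.mk.injEq] at h
      obtain ⟨h1, h2⟩ := h
      exact Prod.ext (by omega) h2
    have hzero : ∀ Nk, Nk ∉ Set.range (fun nk : ℕ × ℕ => (nk.1 + 1 + 2 * nk.2, nk.2)) →
        vtxPowDiag j x Nk = 0 := by
      intro Nk hNk
      unfold vtxPowDiag
      split_ifs with hle
      · exfalso; apply hNk
        exact ⟨(Nk.1 - 1 - 2 * Nk.2, Nk.2), Prod.ext (by simp; omega) (by simp)⟩
      · rfl
    have hG : HasSum (vtxPowDiag j x) (chiralBlock 1 x ^ (j + 1 + 1)) :=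
      (hinj.hasSum_iff hzero).1 ((vtxPowDiag_comp j x).symm ▸ hD)
    refine hG.prod_fiberwise fun N => ?_
    -- the fibre over N is the finite sum defining e_{j+1,N}
    have hfin : ∀ k ∉ range N, vtxPowDiag j x (N, k) = 0 := by
      intro k hk
      rw [Finset.mem_range] at hk
      simp [vtxPowDiag, show ¬ 2 * k + 1 ≤ N by omega]
    have hval : ∑ k ∈ range N, vtxPowDiag j x (N, k) = vtxECoeff (j + 1) N * chiralBlock N x := by
      rw [vtxECoeff_succ, Finset.sum_mul]
      refine sum_congr rfl fun k hk => ?_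
      by_cases h : 2 * k + 1 ≤ N
      · simp only [vtxPowDiag, if_pos h, vtxPowDouble]
        rw [Nat.cast_sub (by omega : 2 * k ≤ N - 1), Nat.cast_sub (by omega : 1 ≤ N)]
        push_cast
        rw [show ((N : ℝ) - 1 - 2 * k) + 1 + 2 * k = N by ring]
        ring
      · simp only [vtxPowDiag, if_neg h, zero_mul]
    rw [← hval]
    exact hasSum_sum_of_ne_finset_zero hfin

end Chiral

end Summit.CriticalPhenomena.Ising3D.Control2D
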